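import Summits.MatrixMultiplication.OmegaCensus.SmallFormats.MatMul22nRankGF7Slack6Flat1
import Summits.MatrixMultiplication.OmegaCensus.SmallFormats.MatMul22nRankGF7Slack6Flat2
import Summits.MatrixMultiplication.OmegaCensus.SmallFormats.MatMul22nRankGF7Slack6Flat3
import Summits.MatrixMultiplication.OmegaCensus.SmallFormats.MatMul22nRankGF7Slack6Flat4
import Summits.MatrixMultiplication.OmegaCensus.SmallFormats.MatMul22nRankGF7Slack6Flat5
import Summits.MatrixMultiplication.OmegaCensus.SmallFormats.MatMul22nRankGF7Slack6Flat6
import Summits.MatrixMultiplication.OmegaCensus.SmallFormats.MatMul22nRankGF7Slack6Flat7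
import Summits.MatrixMultiplication.OmegaCensus.SmallFormats.MatMul22nRankGF7Slack6Pid0
import Summits.MatrixMultiplication.OmegaCensus.SmallFormats.MatMul22nRankGF7Slack6Pid1
import Summits.MatrixMultiplication.OmegaCensus.SmallFormats.MatMul22nRankGF7Slack6Pid2
import Summits.MatrixMultiplication.OmegaCensus.SmallFormats.MatMul22nRankGF7Slack6Pid3
import Summits.MatrixMultiplication.OmegaCensus.SmallFormats.MatMul22nRankGF7Slack6SearchSplit
import Summits.MatrixMultiplication.OmegaCensus.SmallFormats.MatMul22nRankGF7Plane
import HarnessLib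

/-!
# ω-census family (a): the slack-6 checker on the flat (run-time packed) tables and the literal plane — replay interface

Cell `pub-omega` (units `pub-omega-tensor-g18` / `pub-omega-tensor-g19`), topic `Summits/MatrixMultiplication/OmegaCensus` (sub-folder `SmallFormats`).
Framing (verbatim): lottery ticket; floor = certified bounds/negative ranges. HONEST FRAMING: kernel bookkeeping only
(`pub-omega-tensor-g18/KERNEL-S6-SPLIT.md` §4, §7; tensor g19 merged the three interface files into one to save gate layers).
(1) Verbatim copies of the landed search functions on the flat accessors of `MatMul22nRankGF7Slack6Flat1…7` (`gfind6Fl`, `lookup6Fl`,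
`srch6Fl`, `efind6Fl`, `slotOK6Fl`, `laneOK6Fl`, `lanes6Fl`, `repW6Fl`, `state2_6Fl`; piece checkers `searchT6pFl`, `searchT6fFl`, `SearchT6Fl`),
each PROVED EQUAL to the landed function, with the transports `searchT6p_of_Fl`, `searchT6f_of_Fl`, `searchT6_of_Fl`; the linear Boolean
quantifiers `allUpTo` / `anyUpTo` with their soundness lemmas. (2) The literal representative plane: `pid6L` (the four landed chunks `MatMul22nRankGF7Slack6Pid0…3`
reassembled) `= pid6` and the closed-form lane mask `laneMaskL = laneMask5 3692`, both by `decide`; `planeH6L`, `keyPlane6L`, `freePlane6L`,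
`codePlane6L`, `totPlane6L` = the landed plane functions on them, proved equal. (3) The flat MAIN-CHECK piece `mainOK6K h c₀ n` (flat lane
checker on the literal total plane) `= mainOK6p`, whence `lanesOK6_of_pieceK`. Nothing here is progress on `ω`.
-/

namespace Summit.MatrixMultiplication.OmegaCensus.SmallFormats


/-! ## Table lookups -/

/-- Flat copy of `gfind6`. -/
def gfind6Fl (L lo : ℕ) : ℕ → ℕ → ℕ → ℕ
  | 0, a, _ => a
  | fuel + 1, a, b => if b ≤ a then a else
      if low6F L ((a + b) / 2) < lo then gfind6Fl L lo fuel ((a + b) / 2 + 1) b else gfind6Fl L lo fuel a ((a + b) / 2)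

/-- `gfind6Fl = gfind6`. -/
theorem gfind6Fl_eq : gfind6Fl = gfind6 := by
  funext L lo fuel
  induction fuel with
  | zero => funext a b; rfl
  | succ n ih => funext a b; rw [gfind6Fl, gfind6, low6F_eq, ih]

/-- Flat copy of `lookup6`. -/
def lookup6Fl (L K : ℕ) : Option (ℕ × ℕ) :=
  let g := K / k6LoMod L
  let lo := K % k6LoMod L
  let a := goff6F L g
  let b := goff6F L (g + 1)
  let j := gfind6Fl L lo 6 a b
  if j < b ∧ low6F L j = lo then
    some (gent6F L g + coff6F L j, if j + 1 < b then gent6F L g + coff6F L (j + 1) else gent6F L (g + 1))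
  else none

/-- `lookup6Fl = lookup6`. -/
theorem lookup6Fl_eq : lookup6Fl = lookup6 := by
  funext L K; unfold lookup6Fl lookup6; rw [goff6F_eq, gfind6Fl_eq, low6F_eq, gent6F_eq, coff6F_eq]

/-- Flat copy of `repVal6`. -/
def repVal6Fl (c z : ℕ) : ℕ := fld 3 (repPack6F c) z

/-- `repVal6Fl = repVal6`. -/
theorem repVal6Fl_eq : repVal6Fl = repVal6 := by
  funext c z; unfold repVal6Fl repVal6; rw [repPack6F_eq]

/-- Flat copy of `repW6`. -/
def repW6Fl (c : ℕ) : ℕ := ((List.range 18).map fun k => repVal6Fl c (fz6 0 k) * 2 ^ (12 * k)).sum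

/-- `repW6Fl = repW6`. -/
theorem repW6Fl_eq : repW6Fl = repW6 := by
  funext c; unfold repW6Fl repW6; rw [repVal6Fl_eq]

/-- Flat copy of `state2_6`. -/
def state2_6Fl (c e : ℕ) : ℕ := repW6Fl c + expL6 e * 2 ^ 216

/-- `state2_6Fl = state2_6`. -/
theorem state2_6Fl_eq : state2_6Fl = state2_6 := by
  funext c e; unfold state2_6Fl state2_6; rw [repW6Fl_eq]

/-! ## The search -/

/-- Flat copy of `srch6`. -/
def srch6Fl : ℕ → ℕ → ℕ → Bool
  | 0, _, _ => false
  | fuel + 1, L, W => if 21 ≤ L then false else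
      if k6IsBkt L then
        match lookup6Fl L (needKey6 L W) with
        | none => false
        | some (s, e) => (List.range (e - s)).all fun t => srch6Fl fuel (L + 1) (W + expL6 (ent6F L (s + t)) * 2 ^ (12 * k6Base L))
      else (!(hepOK6 (detRes6 L W)) || srch6Fl fuel (L + 1) W)

/-- `srch6Fl = srch6`. -/
theorem srch6Fl_eq : srch6Fl = srch6 := by
  funext fuel
  induction fuel with
  | zero => funext L W; rfl
  | succ n ih => funext L W; rw [srch6Fl, srch6, lookup6Fl_eq, ent6F_eq, ih]; rfl

/-! ## CHECK B pieces -/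

/-- Flat copy of `range1_6`. -/
def range1_6Fl (c : ℕ) : Option (ℕ × ℕ) := lookup6Fl 1 (needKey6 1 (repW6Fl c))

/-- `range1_6Fl = range1_6`. -/
theorem range1_6Fl_eq : range1_6Fl = range1_6 := by
  funext c; unfold range1_6Fl range1_6; rw [lookup6Fl_eq, repW6Fl_eq]

/-- Flat copy of `piecesOK6`. -/
def piecesOK6Fl (c a b : ℕ) : Option (ℕ × ℕ) → Bool
  | none => false
  | some (s, e) => decide (b ≤ e - s) && (List.range (b - a)).all fun i => srch6Fl 20 2 (state2_6Fl c (ent6F 1 (s + (a + i))))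

/-- `piecesOK6Fl = piecesOK6`. -/
theorem piecesOK6Fl_eq : piecesOK6Fl = piecesOK6 := by
  funext c a b r
  rcases r with _ | ⟨s, e⟩
  · rfl
  · simp only [piecesOK6Fl, piecesOK6, srch6Fl_eq, state2_6Fl_eq, ent6F_eq]

/-- Flat copy of `tailOK6`. -/
def tailOK6Fl (c a : ℕ) : Option (ℕ × ℕ) → Bool
  | none => false
  | some (s, e) => (List.range (e - s - a)).all fun i => srch6Fl 20 2 (state2_6Fl c (ent6F 1 (s + (a + i))))

/-- `tailOK6Fl = tailOK6`. -/
theorem tailOK6Fl_eq : tailOK6Fl = tailOK6 := by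
  funext c a r
  rcases r with _ | ⟨s, e⟩
  · rfl
  · simp only [tailOK6Fl, tailOK6, srch6Fl_eq, state2_6Fl_eq, ent6F_eq]

/-- Flat copy of `fullOK6`. -/
def fullOK6Fl (c : ℕ) : Option (ℕ × ℕ) → Bool
  | none => false
  | some (s, e) => (List.range (e - s)).all fun t => srch6Fl 20 2 (state2_6Fl c (ent6F 1 (s + t)))

/-- `fullOK6Fl = fullOK6`. -/
theorem fullOK6Fl_eq : fullOK6Fl = fullOK6 := by
  funext c r
  rcases r with _ | ⟨s, e⟩
  · rfl
  · simp only [fullOK6Fl, fullOK6, srch6Fl_eq, state2_6Fl_eq, ent6F_eq]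

/-- Flat copy of `searchT6p`. -/
def searchT6pFl (c a b : ℕ) : Bool := piecesOK6Fl c a b (range1_6Fl c)

/-- Flat copy of `searchT6f`. -/
def searchT6fFl (c a : ℕ) : Bool := tailOK6Fl c a (range1_6Fl c)

/-- Flat copy of `SearchT6`. -/
def SearchT6Fl (c : ℕ) : Prop := fullOK6Fl c (range1_6Fl c) = true

/-- `SearchT6Fl c` is decided by evaluating the flat Boolean check. -/
instance instDecidableSearchT6Fl (c : ℕ) : Decidable (SearchT6Fl c) := inferInstanceAs (Decidable (fullOK6Fl c (range1_6Fl c) = true))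

/-- **A flat piece is a piece.** -/
theorem searchT6p_of_Fl {c a b : ℕ} (h : searchT6pFl c a b = true) : searchT6p c a b = true := by
  unfold searchT6pFl at h; rw [piecesOK6Fl_eq, range1_6Fl_eq] at h; exact h

/-- **A flat tail is a tail.** -/
theorem searchT6f_of_Fl {c a : ℕ} (h : searchT6fFl c a = true) : searchT6f c a = true := by
  unfold searchT6fFl at h; rw [tailOK6Fl_eq, range1_6Fl_eq] at h; exact h

/-- **The flat full check gives `SearchT6 c`.** -/
theorem searchT6_of_Fl {c : ℕ} (h : SearchT6Fl c) : SearchT6 c := by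
  unfold SearchT6Fl at h; rw [fullOK6Fl_eq, range1_6Fl_eq] at h; exact h

/-! ## The MAIN CHECK -/

/-- Flat copy of `efind6`. -/
def efind6Fl (L e : ℕ) : ℕ → ℕ → ℕ → ℕ
  | 0, a, _ => a
  | fuel + 1, a, b => if b ≤ a then a else
      if ent6F L ((a + b) / 2) < e then efind6Fl L e fuel ((a + b) / 2 + 1) b else efind6Fl L e fuel a ((a + b) / 2)

/-- `efind6Fl = efind6`. -/
theorem efind6Fl_eq : efind6Fl = efind6 := by
  funext L e fuel
  induction fuel with
  | zero => funext a b; rfl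
  | succ n ih => funext a b; rw [efind6Fl, efind6, ent6F_eq, ih]

/-- Flat copy of `slotOK6`. -/
def slotOK6Fl (L c code : ℕ) : Bool :=
  let key := code / 2 ^ 39
  let e := code % 2 ^ 39
  (bm6F L (key % 2 ^ bmb6 L) == 0) ||
  match lookup6Fl L key with
  | none => true
  | some (s, en) =>
      if L = 1 ∧ isTab6 c = false then
        (List.range (nkoff6F (goff6F 1 key + 1) - nkoff6F (goff6F 1 key))).all fun i =>
          srch6Fl 20 2 (state2_6Fl (clsByNeed6F (nkoff6F (goff6F 1 key) + i)) e)
      else decide (efind6Fl L e 9 s en < en) && (ent6F L (efind6Fl L e 9 s en) == e)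

/-- `slotOK6Fl = slotOK6`. -/
theorem slotOK6Fl_eq : slotOK6Fl = slotOK6 := by
  funext L c code
  unfold slotOK6Fl slotOK6
  rw [bm6F_eq, lookup6Fl_eq, nkoff6F_eq, goff6F_eq, srch6Fl_eq, state2_6Fl_eq, clsByNeed6F_eq, efind6Fl_eq, ent6F_eq]
  rfl

/-- Flat copy of `laneOK6`. -/
def laneOK6Fl (c K : ℕ) : Bool := (List.range 7).all fun j => slotOK6Fl (bktLev6 j) c ((K >>> (82 * j)) % 2 ^ 82)

/-- `laneOK6Fl = laneOK6`. -/
theorem laneOK6Fl_eq : laneOK6Fl = laneOK6 := by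
  funext c K; unfold laneOK6Fl laneOK6; rw [slotOK6Fl_eq]

/-- Flat copy of `lanes6`. -/
def lanes6Fl : ℕ → ℕ → ℕ → ℕ → Bool
  | 0, _, _, _ => false
  | fuel + 1, c, n, K => if n = 0 then true else if n = 1 then laneOK6Fl c (K % 2 ^ 588) else
      lanes6Fl fuel c (n / 2) (K &&& (2 ^ (588 * (n / 2)) - 1)) && lanes6Fl fuel (c + n / 2) (n - n / 2) (K >>> (588 * (n / 2)))

/-- `lanes6Fl = lanes6`. -/
theorem lanes6Fl_eq : lanes6Fl = lanes6 := by
  funext fuel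
  induction fuel with
  | zero => funext c n K; rfl
  | succ m ih => funext c n K; rw [lanes6Fl, lanes6, laneOK6Fl_eq, ih]

/-! ## Linear Boolean quantifiers (the replay files and the table-fact files decide batches with them)

Same primitive recursions as `allBelow` / `anyBelow` of `MatMul22nRankGF7Slack6FastSearch` (a `decide` over `∀ i : Fin n, …` builds
nested `Nat.decidableBallLT` closures, quadratic in `n`); restated here under their own names so that the replay interface does not import
the fast-accessor files. -/

/-- `f (n-1) && … && f 0` by primitive recursion on `n`. -/
noncomputable def allUpTo (n : ℕ) (f : ℕ → Bool) : Bool := Nat.rec true (fun k acc => f k && acc) n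

/-- Unfolding `allUpTo` at a successor. -/
theorem allUpTo_succ (n : ℕ) (f : ℕ → Bool) : allUpTo (n + 1) f = (f n && allUpTo n f) := rfl

/-- **`allUpTo` is sound:** every index below `n` passes. -/
theorem allUpTo_sound {f : ℕ → Bool} : ∀ {n : ℕ}, allUpTo n f = true → ∀ k < n, f k = true
  | 0, _, k, hk => absurd hk (Nat.not_lt_zero k)
  | n + 1, h, k, hk => by
    rw [allUpTo_succ, Bool.and_eq_true] at h
    rcases Nat.lt_succ_iff_lt_or_eq.1 hk with hk' | rfl
    · exact allUpTo_sound h.2 k hk'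
    · exact h.1

/-- `f (n-1) || … || f 0` by primitive recursion on `n`. -/
noncomputable def anyUpTo (n : ℕ) (f : ℕ → Bool) : Bool := Nat.rec false (fun k acc => f k || acc) n

/-- Unfolding `anyUpTo` at a successor. -/
theorem anyUpTo_succ (n : ℕ) (f : ℕ → Bool) : anyUpTo (n + 1) f = (f n || anyUpTo n f) := rfl

/-- **`anyUpTo` is sound:** some index below `n` passes. -/
theorem anyUpTo_sound {f : ℕ → Bool} : ∀ {n : ℕ}, anyUpTo n f = true → ∃ k < n, f k = true
  | 0, h => absurd h Bool.false_ne_true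
  | n + 1, h => by
    rw [anyUpTo_succ, Bool.or_eq_true] at h
    rcases h with h | h
    · exact ⟨n, Nat.lt_succ_self n, h⟩
    · obtain ⟨k, hk, hfk⟩ := anyUpTo_sound h
      exact ⟨k, Nat.lt_succ_of_lt hk, hfk⟩

/-! ## The literal representative plane and the total plane of an element -/

/-- The representative plane, reassembled from the four literal chunks. -/
def pid6L : ℕ := pid6C0 + pid6C1 * 2 ^ (588 * 923) + pid6C2 * 2 ^ (588 * 1846) + pid6C3 * 2 ^ (588 * 2769)

set_option maxRecDepth 100000 in
set_option maxHeartbeats 400000000 in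
/-- **The literal plane is `pid6`.** -/
theorem pid6L_eq : pid6L = pid6 := by decide +kernel

/-- The lane mask `laneMask5 3692` in closed form (four bignum operations instead of a 3 692-term sum). -/
def laneMaskL : ℕ := (2 ^ 14 - 1) * ((2 ^ (588 * 3692) - 1) / (2 ^ 588 - 1))

set_option maxRecDepth 100000 in
set_option maxHeartbeats 400000000 in
/-- **The closed-form mask is `laneMask5 3692`.** -/
theorem laneMaskL_eq : laneMaskL = laneMask5 3692 := by decide +kernel

/-- `resid5 3692` with the closed-form mask. -/
def resid5L (X : ℕ) : ℕ := X - 7 * (((X * 18725) >>> 17) &&& laneMaskL)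

/-- `resid5L = resid5 3692`. -/
theorem resid5L_eq : resid5L = resid5 3692 := by
  funext X; unfold resid5L resid5; rw [laneMaskL_eq]

/-- `planeH6` on the literal plane and closed-form mask. -/
def planeH6L (h : ℕ) : ℕ := ((List.range 42).map fun z => ((pid6L >>> (14 * omAct7 h z)) &&& laneMaskL) * 2 ^ (14 * z)).sum

/-- `planeH6L = planeH6`. -/
theorem planeH6L_eq : planeH6L = planeH6 := by
  funext h; unfold planeH6L planeH6; rw [pid6L_eq, laneMaskL_eq]

/-- `keyPlane6` with the closed-form mask. -/
def keyPlane6L (L PH : ℕ) : ℕ :=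
  ((List.range (k6Ncr L)).map fun j => resid5L (((PH * ag6 L j) >>> 574) &&& laneMaskL) * 7 ^ j).sum

/-- `keyPlane6L = keyPlane6`. -/
theorem keyPlane6L_eq : keyPlane6L = keyPlane6 := by
  funext L PH; unfold keyPlane6L keyPlane6; rw [resid5L_eq, laneMaskL_eq]

/-- `freePlane6` with the closed-form mask. -/
def freePlane6L (L PH : ℕ) : ℕ := ((List.range (k6NFree L)).map fun k => ((PH >>> (14 * fz6 L k)) &&& laneMaskL) * 2 ^ (3 * k)).sum

/-- `freePlane6L = freePlane6`. -/
theorem freePlane6L_eq : freePlane6L = freePlane6 := by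
  funext L PH; unfold freePlane6L freePlane6; rw [laneMaskL_eq]

/-- `codePlane6` with the closed-form mask. -/
def codePlane6L (L PH : ℕ) : ℕ := keyPlane6L L PH * 2 ^ 39 + freePlane6L L PH

/-- `codePlane6L = codePlane6`. -/
theorem codePlane6L_eq : codePlane6L = codePlane6 := by
  funext L PH; unfold codePlane6L codePlane6; rw [keyPlane6L_eq, freePlane6L_eq]

/-- `totPlane6` on the literal plane. -/
def totPlane6L (h : ℕ) : ℕ := ((List.range 7).map fun j => codePlane6L (bktLev6 j) (planeH6L h) * 2 ^ (82 * j)).sum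

/-- `totPlane6L = totPlane6`. -/
theorem totPlane6L_eq : totPlane6L = totPlane6 := by
  funext h; unfold totPlane6L totPlane6; rw [planeH6L_eq, codePlane6L_eq]

/-! ## The flat MAIN-CHECK piece -/

/-- **Flat MAIN-CHECK piece:** lanes `c₀ … c₀ + n − 1` of the total plane of element `h` (literal plane, flat lane checker). -/
def mainOK6K (h c₀ n : ℕ) : Bool := lanes6Fl 13 c₀ n ((totPlane6L h >>> (588 * c₀)) % 2 ^ (588 * n))

/-- `mainOK6K = mainOK6p`. -/
theorem mainOK6K_eq : mainOK6K = mainOK6p := by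
  funext h c n; unfold mainOK6K mainOK6p; rw [lanes6Fl_eq, totPlane6L_eq]

/-- **A flat MAIN-CHECK piece certifies its lanes.** -/
theorem lanesOK6_of_pieceK {h a n : ℕ} (hp : mainOK6K h a n = true) : LanesOK6 h a (a + n) :=
  lanesOK6_of_piece (by rw [mainOK6K_eq] at hp; exact hp)

end Summit.MatrixMultiplication.OmegaCensus.SmallFormats
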